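import Summits.HodgeConjecture.CorCM.AndreSplitWeilTypeTwist
import Summits.HodgeConjecture.HodgeConjecture.Theorems.Ring2HypothesesWeilComponentsCMRosati
import Literature.AlgebraicGeometry.ComplexMultiplication.CMAbelianVarietyRealisedHolds
import Literature.AlgebraicGeometry.HodgeTheory.CMProductsHodgeConjectureOfCodimTwo
import HarnessLib

/-!
# Ring 2 — Weil-type family-coverage census, CM-field rows (X-A): EVERY δ-cell `(E, 2p, δ)` of a Galois CM field
# `E` with `[E:ℚ] > 2` is INHABITED by a CM product member — Deligne 1982 §5 (c) with an ARBITRARY target class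

HONEST FRAMING: research route conditional on HC_CM; not a corollary; Q11.4-sentence-2 already refuted in dim ≥ 3.

Cell `pub-hodge-ring2`, seat `ring2-b03` (gen 55), census `WEIL-FAMILY-COVERAGE.md` «## b03» (CM fields `[E:ℚ] > 2`),
column «split special fibre? (which)» / (F2) «CM product member on EVERY row» (block b03.6). THEOREMS ONLY: no `def`,
no named fact, no `sorry`; nothing here is a case of the Hodge conjecture, `HC_CM`
(`Theses.RankFourFaces.CMAbelianHodge`) does not occur in this file.

WHAT IS PROVED. Part VII-C of the hypotheses layer (`Ring2HypothesesWeilComponentsCM`) indexes the Weil-class targets of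
a CM field `E = ℚ[T]/(R(T²))` by the components `(E, d = 2p, δ)`, `δ ∈ F^×/Nm_{E/F}(E^×) = cmNormResidueGroup R`
(`WeilClassesComponentCM R e₀ p δ`: for `(A, η)` of Weil type, a polarization CLASS `h` — rational, divisorial, hard
Lefschetz — Rosati-compatible with `η` and of Deligne discriminant `δ`, every rational `(p,p)` Weil class is
algebraic). For imaginary QUADRATIC `K` the twin cells are known to be inhabited exactly on the right sign
(`Ring2.AbelianAll.weilClassesComponent_inhabited_iff_sign`, ab-weil-1 gen 8). Here, for the CM-FIELD axis:

* §1 `exists_polarizationClass_hasWeilDiscriminantCM_of_constantSum` — Deligne §5 (c) with an ARBITRARY target: for `K`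
  a Galois CM field with `[K:ℚ] > 2`, realisations `(B_j, Ψ_j)`, `j < d = 2p`, of CM types with CONSTANT SUM `p`, and
  Deligne's presentation `R(T²) = minpoly_ℤ(b₀)` of a purely imaginary separating integer `b₀`, the diagonal datum
  `(⨁ B, ⊕ act_j(b₀))` is of Weil type AND carries, for EVERY class `δ ∈ F^×/Nm(E^×)`, a polarization class `h_δ`,
  Rosati-compatible with `η`, with `HasWeilDiscriminantCM (⨁ B) η R e₀ p h_δ δ`. This is the proof of the CorCM seat's
  `AndreSplit.isSplitWeilTypeCM_of_constantSum` (lit-milne gen 56) VERBATIM with the split class `[(-1)^p]` replaced by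
  `δ` in the one call to `Deligne1982.exists_ringOfIntegers_real_prod_eq` («after replacing one `fᵢ` with `fᵢ/f` …»
  reaches ANY prescribed class — the Literature theorem is already stated for every `δ`). COUNT ONCE: the
  construction is Deligne's / the Literature seat's; this file only re-targets it.
* §2 `exists_cmMember_hasWeilDiscriminantCM` — INHABITEDNESS: for `K`, `b₀`, `R` as above, every `p ≥ 1` and EVERY `δ`
  there is `(A, η, h)` with `A` OF CM TYPE (`Milne1999.IsOfCMType`), `IsWeilTypeCM A η R e₀ p`, `h` a polarization class,
  `RosatiCompatible A η h`, `HasWeilDiscriminantCM A η R e₀ p h δ` — take `B_j` realising a CM type `Ψ₀` for `j < p` and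
  its complement `Ψ₀ᶜ` for `j ≥ p` (Shimura §6.2 Thm. 3: `ComplexMultiplication.exists_isCMTypeRealisation`); this is
  the census's `B^p × (B^ρ)^p` (b03.6) up to the choice of the second realisation. The companion part X-B
  (`Ring2WeilCoverageCMFieldCellsNonvacuous`) produces the presentation `(b₀, R, e₀)` from `K` and reads the result
  in the vocabulary of the cells (`WeilClassesComponentCM R e₀ p δ` is never a statement about the empty set; its
  conclusion bites on a NON-ZERO rational `(p,p)` Weil class at the CM member).

HONEST COLUMN. (i) `HodgeTheory.IsPolarizationClass` records NO positivity, so on the carriers EVERY class `δ` is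
reached — including the classes of the «wrong» sign at the real places of `F`, whose rows the census marks EMPTY for
genuinely POLARIZED members (Deligne p. 30 (1): `sign_τ disc φ = (-1)^{b_τ}`); the Kähler-multiple refinement for
totally positive twists is the CorCM seat's `AndreSplitWeilTypePolarized` (split class only) and is NOT extended here.
(ii) `[IsGalois ℚ K]` is inherited from `AndreSplit.isWeilTypeCM_diagHom`; the non-Galois census field `ℚ(√-(3+√2))`
is not covered. (iii) HC at the inhabitant (`Hdg = Div` on `B^{2p}`, Pohlmann / Hazama–Murty) is the census's print
column and is not re-proved here.

## References
* [Deligne1982HodgeCycles] P. Deligne (notes by J. S. Milne), *Hodge cycles on abelian varieties*, LNM 900 (1982), §4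
  p. 30 (1), Cor. 4.2, Prop. 4.4, Lemma 4.6; §5 (c) pp. 38–39.
* [Milne2020HodgeClassesAV] J. S. Milne, arXiv:2010.08857, §2 2.1–2.2.
* [Shimura1998] G. Shimura, *Abelian Varieties with Complex Multiplication and Modular Functions* (1998), §6.2 Thm. 3.
* [MoonenZarhin1998WeilClasses] B. Moonen, Yu. Zarhin, J. reine angew. Math. 496 (1998), §1.
* [vanGeemen1994HodgeAV] B. van Geemen, LNM 1594 (1994), 4.11, 4.14 (the quadratic twin).
-/

noncomputable section

set_option linter.dupNamespace false

namespace Summit.HodgeConjecture.HodgeConjecture.Ring2.WeilCoverageCM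

open CategoryTheory CategoryTheory.Limits Polynomial NumberField
open Literature.AlgebraicTopology.SingularHomology
open Literature.AlgebraicGeometry Literature.AlgebraicGeometry.Motives Literature.AlgebraicGeometry.HodgeTheory
open Literature.AlgebraicGeometry.ComplexMultiplication Literature.AlgebraicGeometry.Deligne1982
open Literature.AlgebraicGeometry.Milne1999
open Literature.Geometry.Kaehler (lefschetzPow HasHardLefschetzProperty)
open Literature.AlgebraicGeometry.VanGeemen1994 (pullbackOne)
open Literature.NumberTheory.Automorphic.PicardCM (eigenline)
open Summit.HodgeConjecture.CorCM.AndreProductForm Summit.HodgeConjecture.CorCM.Milne2020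
open Summit.HodgeConjecture.CorCM.AndreSplit
open Summit.HodgeConjecture.HodgeConjecture.Theorems
open Summit.HodgeConjecture.HodgeConjecture.Ring2.Hypotheses (RosatiCompatible)

/-! ## §1 Deligne §5 (c) with an arbitrary target class: the twisted product class of discriminant `δ` -/

section Twist

variable (K : Type) [Field K] [NumberField K] [IsCMField K] [IsGalois ℚ K]

open scoped Classical in
/-- **Deligne 1982 §5 (c) with an ARBITRARY target class.** For `K` a Galois CM field with `[K:ℚ] > 2`, realisations
`(B_j, Ψ_j)`, `j < d = 2p`, with constant sum `p`, and `b₀ ∈ 𝓞_K` purely imaginary separating the embeddings with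
Deligne's presentation `R(T²) = minpoly_ℤ(b₀)`: the diagonal datum `(⨁ B, η = ⊕ act_j(b₀))` is of Weil type on the
carriers AND, for EVERY `δ ∈ F^×/Nm(E^×)`, carries a polarization class `h` (rational, divisorial, hard Lefschetz),
Rosati-compatible with `η`, with `HasWeilDiscriminantCM (⨁ B) η R e₀ p h δ`. Proof = the CorCM seat's
`isSplitWeilTypeCM_of_constantSum` with the target of `Deligne1982.exists_ringOfIntegers_real_prod_eq` set to `δ`: slot
Rosati classes with hermitian coefficients `ζ_j` (`exists_rosatiClass_hermitianCoeff`), Milne's product class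
(`isPolarizationClass_sumPolarizationClass`, `polarizationPairingOne_sum_pullbackOne_diag_skew`), its discriminant
`[∏ F_j]` (`hasWeilDiscriminantCM_sumPolarizationClass`), and the real twist of slot `0` (`ζ₀ ↦ ζ₀/(2f)`). No positivity
is recorded (honest column (i) of the module docstring). [cite: Deligne1982HodgeCycles, §5 (c) pp. 38–39 and §4 Lemma 4.6]
[cite: Milne2020HodgeClassesAV, §2 2.1–2.2] -/
theorem exists_polarizationClass_hasWeilDiscriminantCM_of_constantSum (hK : 2 < Module.finrank ℚ K)
    {d p : ℕ} (hd : d = 2 * p) (hp : 0 < p) (B : Fin d → AbelianVariety ℂ)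
    (act : ∀ j, 𝓞 K →+* End (B j)) {θB : ∀ j, K →+* Module.End ℂ (complexBetti (B j).X 1)}
    {Ψ : Fin d → CMType K} (hB : ∀ j, IsCMTypeRealisation (Ψ j) (B j) (act j) (θB j))
    (hadm : ∀ s : K →+* ℂ, (Finset.univ.filter fun j : Fin d => s ∈ (Ψ j).1).card = p)
    {b₀ : 𝓞 K} (hb₀ : IsCMField.complexConj K (b₀ : K) = -(b₀ : K))
    (hsep : Function.Injective fun σ : K →+* ℂ => σ (b₀ : K))
    {R : Polynomial ℤ} {e₀ : ℕ} (he : Module.finrank ℚ K = 2 * e₀) (hRm : R.Monic) (hRdeg : R.natDegree = e₀)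
    (hR : R.comp (X ^ 2) = minpoly ℤ b₀) (hirr : Irreducible (cmPolyQ R))
    (hroots : ∀ s : ℂ, Polynomial.eval₂ (Int.castRingHom ℂ) s R = 0 → s.im = 0 ∧ s.re < 0)
    (haev : Polynomial.aeval (b₀ : K) (cmPolyQ R) = 0) (hdegQ : (cmPolyQ R).natDegree = Module.finrank ℚ K)
    [Fact (Irreducible (realPolyQ R))] (δ : cmNormResidueGroup R) :
    IsWeilTypeCM (⨁ B) (diagHom K B act b₀) R e₀ p ∧
      ∃ h : complexBetti (⨁ B).X 2, IsPolarizationClass (⨁ B).dim (⨁ B).X h ∧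
        RosatiCompatible (⨁ B) (diagHom K B act b₀) h ∧ HasWeilDiscriminantCM (⨁ B) (diagHom K B act b₀) R e₀ p h δ := by
  -- `d = n + 1`
  obtain ⟨n, rfl⟩ : ∃ n, d = n + 1 := ⟨d - 1, by omega⟩
  have hW : IsWeilTypeCM (⨁ B) (diagHom K B act b₀) R e₀ p :=
    isWeilTypeCM_diagHom K hd hp B act hB hadm b₀ hsep he hRm hRdeg hR hirr hroots
  haveI hfE : Fact (Irreducible (cmPolyQ R)) := ⟨hirr⟩
  refine ⟨hW, ?_⟩
  -- eigenbases of the slots and the diagonal action on them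
  have hv : ∀ j, ∃ v : Module.Basis (K →+* ℂ) ℂ (complexBetti (B j).X 1), ∀ σ, v σ ∈ eigenline (θB j) σ :=
    fun j => exists_eigenbasis (hB j)
  choose b hbmem using hv
  have hb : ∀ a (c : 𝓞 K) (σ : K →+* ℂ),
      complexBetti.map (act a c : B a ⟶ B a).hom.hom.hom 1 (b a σ) = σ (c : K) • b a σ :=
    fun a c σ => map_ι_apply_of_mem_eigenline (hB a) (hbmem a σ) c
  have htype : ∀ a σ, σ ∈ (Ψ a).1 → IsOfHodgeType (B a).dim (B a).X 1 1 0 (b a σ) :=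
    fun a σ hσ => isOfHodgeType_oneZero_of_mem (hB a) (hbmem a σ) hσ
  -- `dim B_a = e₀ ≥ 2`
  have hdimB : ∀ a, (B a).dim = e₀ := fun a => by
    rw [dim_eq_of_isCMTypeRealisation (hB a), he, Nat.mul_div_cancel_left _ two_pos]
  have he2 : 2 ≤ e₀ := by omega
  have hdim2 : ∀ a, 2 ≤ (B a).dim := fun a => by rw [hdimB a]; exact he2
  have hdim0 : ∀ a, 0 < (B a).dim := fun a => by have := hdim2 a; omega
  have h2 : 2 ≤ (cmPolyQ R).natDegree := by rw [hdegQ]; omega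
  -- Deligne's slot data: Rosati classes `h_a`, rational generators `x_a`, hermitian coefficients `ζ_a`
  have hslot := fun a => exists_rosatiClass_hermitianCoeff (hdim2 a) (hb a) (Ψ a) (htype a)
  choose h x ζ hQ halg hKm htop hkill hros hxQ hx0 hcomp hζ hcoef htr hsign using hslot
  -- `ζ_a ≠ 0` (a CM type is non-empty)
  have hζ0 : ∀ a, ζ a ≠ 0 := by
    intro a h0
    obtain ⟨σ⟩ : Nonempty (K →+* ℂ) := inferInstance
    have hno : ∀ τ : K →+* ℂ, τ ∉ (Ψ a).1 := by
      intro τ hτ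
      rcases hsign a with hs | hs
      · have h1 := (hs τ).1 hτ
        rw [h0, map_zero, Complex.zero_im] at h1
        exact lt_irrefl _ h1
      · have h1 := (hs τ).1 hτ
        rw [h0, map_zero, Complex.zero_im] at h1
        exact lt_irrefl _ h1
    exact hno σ (((Ψ a).2 σ).mpr (hno _))
  -- hard Lefschetz / polarization class / top power of the slot classes, from their Kähler multiples
  have hHL : ∀ a, HasHardLefschetzProperty (h a) (B a).dim := fun a => by
    obtain ⟨s, hs, hsK⟩ := hKm a
    have h1 := HasHardLefschetzProperty.smul
      (hsK.hasHardLefschetzProperty (AbelianVariety.isSmoothProjective_holds (A := B a))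
        fun _ => Motives.hasHardLefschetzProperty_kaehlerClass_holds)
      (inv_ne_zero (Complex.ofReal_ne_zero.2 hs))
    rwa [smul_smul, inv_mul_cancel₀ (Complex.ofReal_ne_zero.2 hs), one_smul] at h1
  have hpol : ∀ a, IsPolarizationClass (B a).dim (B a).X (h a) := fun a => ⟨hQ a, halg a, hHL a⟩
  have htop' : ∀ a, lefschetzPow (h a) ((B a).dim - 1) 2 (h a) ≠ 0 := fun a => by
    obtain ⟨s, -, hsK⟩ := hKm a
    exact lefschetzPow_self_ne_zero_of_isKaehlerClass_smul (hdim0 a) hsK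
  -- the identification `E ≅ K`, `t ↦ b₀`, and the real elements `b₀ ζ_a ∈ F^×`
  obtain ⟨κ, hκ⟩ := exists_algEquiv_cmField R haev hdegQ
  obtain ⟨F, hF⟩ := exists_units_realToCM_eq R κ hκ hb₀ hsep h2 ζ hζ hζ0
  -- «After replacing one `fᵢ` with `fᵢ/f` …»: the twist of slot `0`, aimed at the class `δ`
  obtain ⟨f, hf, hf0, hfprop⟩ := exists_ringOfIntegers_real_prod_eq R κ hκ hb₀ F (0 : Fin (n + 1)) δ
  have hA0 : (B 0).dim = ((B 0).dim - 1) + 1 := by have := hdim0 0; omega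
  set T : complexBetti (B 0).X 2 :=
    complexBetti.map (𝟙 (B 0) + (show B 0 ⟶ B 0 from act 0 f)).hom.hom.hom 2 (h 0) - h 0 -
      complexBetti.map (show B 0 ⟶ B 0 from act 0 f).hom.hom.hom 2 (h 0) with hTdef
  set h' : ∀ a, complexBetti (B a).X 2 := Function.update h 0 T with hh'def
  set ζ' : Fin (n + 1) → K := Function.update ζ 0 (ζ 0 / (2 * (f : K))) with hζ'def
  have hh'0 : h' 0 = T := by rw [hh'def, Function.update_self]
  have hh'a : ∀ a, a ≠ 0 → h' a = h a := fun a ha => by rw [hh'def, Function.update_of_ne ha]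
  have hζ'0 : ζ' 0 = ζ 0 / (2 * (f : K)) := by rw [hζ'def, Function.update_self]
  have hζ'a : ∀ a, a ≠ 0 → ζ' a = ζ a := fun a ha => by rw [hζ'def, Function.update_of_ne ha]
  -- the twisted slot: polarization class, Rosati, top power, hermitian coefficient `ζ₀/(2f)`
  have hpolT : IsPolarizationClass (B 0).dim (B 0).X T :=
    isPolarizationClass_realTwist (τ := fun σ : K →+* ℂ => σ) (hb 0) (Ψ 0) hf hf0 (hkill 0) (hQ 0) (halg 0)
      (hHL 0)
  have hrosT : ∀ (c cc : 𝓞 K), (cc : K) = IsCMField.complexConj K (c : K) → ∀ y z : complexBetti (B 0).X 1,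
      polarizationPairingOne (B 0).X T ((B 0).dim - 1) (complexBetti.map (act 0 c : B 0 ⟶ B 0).hom.hom.hom 1 y) z =
        polarizationPairingOne (B 0).X T ((B 0).dim - 1) y
          (complexBetti.map (act 0 cc : B 0 ⟶ B 0).hom.hom.hom 1 z) :=
    fun c cc hcc y z => realTwist_rosati (τ := fun σ : K →+* ℂ => σ) (hdim0 0) (hb 0) f (hkill 0) c cc hcc y z
  obtain ⟨dT, hdT0, -, htopT, -⟩ :=
    exists_scalar_realTwist_self hA0 (hb 0) (Ψ 0) hf hf0 (hkill 0) (hros 0)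
  have hcoefT : ∀ σ : K →+* ℂ, polarizationPairingOne (B 0).X T ((B 0).dim - 1) ((b 0).coord σ (x 0) • b 0 σ)
      ((b 0).coord (ComplexEmbedding.conjugate σ) (x 0) • b 0 (ComplexEmbedding.conjugate σ)) =
      σ (ζ 0 / (2 * (f : K))) • lefschetzPow T ((B 0).dim - 1) 2 T :=
    fun σ => realTwist_eigenCoeff hA0 (hb 0) (Ψ 0) hf hf0 (hkill 0) (hros 0) (hcoef 0) σ
  -- the twisted family
  have hpol' : ∀ a, IsPolarizationClass (B a).dim (B a).X (h' a) := by
    intro a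
    by_cases ha : a = 0
    · subst ha; rw [hh'0]; exact hpolT
    · rw [hh'a a ha]; exact hpol a
  have hQ' : ∀ a, IsRationalClass (h' a) := fun a => (hpol' a).1
  have htop'' : ∀ a, lefschetzPow (h' a) ((B a).dim - 1) 2 (h' a) ≠ 0 := by
    intro a
    by_cases ha : a = 0
    · subst ha; rw [hh'0, htopT]; exact smul_ne_zero hdT0 (htop' 0)
    · rw [hh'a a ha]; exact htop' a
  have hros' : ∀ a (c cc : 𝓞 K), (cc : K) = IsCMField.complexConj K (c : K) → ∀ y z : complexBetti (B a).X 1,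
      polarizationPairingOne (B a).X (h' a) ((B a).dim - 1)
          (complexBetti.map (act a c : B a ⟶ B a).hom.hom.hom 1 y) z =
        polarizationPairingOne (B a).X (h' a) ((B a).dim - 1) y
          (complexBetti.map (act a cc : B a ⟶ B a).hom.hom.hom 1 z) := by
    intro a
    by_cases ha : a = 0
    · subst ha; rw [hh'0]; exact hrosT
    · rw [hh'a a ha]; exact hros a
  have hζ' : ∀ a, IsCMField.complexConj K (ζ' a) = -ζ' a := by
    intro a
    by_cases ha : a = 0
    · subst ha; rw [hζ'0]; exact imaginary_div_real (hζ 0) hf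
    · rw [hζ'a a ha]; exact hζ a
  have hζ'ne : ∀ a, ζ' a ≠ 0 := by
    intro a
    by_cases ha : a = 0
    · subst ha; rw [hζ'0]; exact div_ne_zero (hζ0 0) (mul_ne_zero two_ne_zero hf0)
    · rw [hζ'a a ha]; exact hζ0 a
  have hcoef' : ∀ a (σ : K →+* ℂ), polarizationPairingOne (B a).X (h' a) ((B a).dim - 1)
      ((b a).coord σ (x a) • b a σ)
      ((b a).coord (ComplexEmbedding.conjugate σ) (x a) • b a (ComplexEmbedding.conjugate σ)) =
      σ (ζ' a) • lefschetzPow (h' a) ((B a).dim - 1) 2 (h' a) := by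
    intro a
    by_cases ha : a = 0
    · subst ha; rw [hh'0, hζ'0]; exact hcoefT
    · rw [hh'a a ha, hζ'a a ha]; exact hcoef a
  obtain ⟨F', hF'⟩ := exists_units_realToCM_eq R κ hκ hb₀ hsep h2 ζ' hζ' hζ'ne
  -- the class of the twisted family is `δ`
  have hclass : (QuotientGroup.mk (∏ a, F' a) : cmNormResidueGroup R) = δ := by
    refine hfprop F' ?_ fun a ha => ?_
    · rw [hF', hF, ← map_mul, hζ'0]
      congr 1
      field_simp
    · apply Units.ext
      apply (realToCM R).injective
      rw [hF', hF, hζ'a a ha]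
  -- Deligne §5 (c) on the carriers: the discriminant of the product class of the twisted family
  have hk : n + 1 = 2 * p := hd
  have hdisc := hasWeilDiscriminantCM_sumPolarizationClass R hb hsep κ hκ he hk hQ' htop'' hros' hxQ hx0 hcoef' hF'
  rw [hclass] at hdisc
  exact ⟨sumPolarizationClass B h', isPolarizationClass_sumPolarizationClass B h' hpol',
    polarizationPairingOne_sum_pullbackOne_diag_skew hb hdim0 hros' hb₀, hdisc⟩

end Twist

/-! ## §2 Inhabitedness: every δ-cell of a Galois CM field contains a CM product member -/

section Inhabited

variable (K : Type) [Field K] [NumberField K] [IsCMField K] [IsGalois ℚ K]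

/-- `#{j < 2p | j < p} = p` in `Fin (2p)`. [folklore] -/
private theorem card_filter_val_lt (p : ℕ) :
    ((Finset.univ : Finset (Fin (2 * p))).filter fun j : Fin (2 * p) => (j : ℕ) < p).card = p := by
  refine Finset.card_eq_of_bijective (fun i (hi : i < p) => (⟨i, by omega⟩ : Fin (2 * p))) (fun a ha => ?_)
    (fun i hi => ?_) fun i j hi hj hij => ?_
  · exact ⟨a, (Finset.mem_filter.1 ha).2, rfl⟩
  · exact Finset.mem_filter.2 ⟨Finset.mem_univ _, hi⟩
  · exact Fin.mk.inj_iff.mp hij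

/-- `#{j < 2p | ¬ j < p} = p` in `Fin (2p)`. [folklore] -/
private theorem card_filter_not_val_lt (p : ℕ) :
    ((Finset.univ : Finset (Fin (2 * p))).filter fun j : Fin (2 * p) => ¬ (j : ℕ) < p).card = p := by
  have h := Finset.card_filter_add_card_filter_not (s := (Finset.univ : Finset (Fin (2 * p))))
    (fun j : Fin (2 * p) => (j : ℕ) < p)
  rw [card_filter_val_lt, Finset.card_univ, Fintype.card_fin] at h
  omega

open scoped Classical in
/-- **Every δ-cell `(E, 2p, δ)` of a Galois CM field is INHABITED by a CM product member.** For `K` a Galois CM field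
with `[K:ℚ] > 2`, `b₀ ∈ 𝓞_K` purely imaginary separating with Deligne's presentation `R(T²) = minpoly_ℤ(b₀)`
(`E = ℚ[T]/(R(T²)) ≅ K`, `F = ℚ[S]/(R) = E⁺`), every `p ≥ 1` and EVERY class `δ ∈ F^×/Nm_{E/F}(E^×)`: there is a
complex abelian variety `A` OF CM TYPE with `η ∈ End A` and a class `h ∈ H²(A)` such that `(A, η)` is of Weil type
`IsWeilTypeCM A η R e₀ p` (`dim A = 2p·e₀`, all multiplicities `p`), `h` is a polarization class (rational, divisorial,
hard Lefschetz) whose Rosati involution is complex conjugation on `E`, and `disc = δ` (`HasWeilDiscriminantCM`).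
Construction: `A = B₀^p × B₁^p` with `B₀` realising a CM type `Ψ₀` and `B₁` its complement `Ψ₀ᶜ` (Shimura §6.2
Thm. 3, `exists_isCMTypeRealisation`; constant sum `p`), `η = ⊕ act(b₀)`, `h` from §1 — the census's (F2) member
`B² × (B^ρ)²` with the factor-one twist `f₁ ↦ [f₁ c]` (b03.6, Deligne §5 (c)). [cite: Deligne1982HodgeCycles, §5 (c) pp. 38–39]
[cite: Shimura1998, §6.2 Theorem 3] [cite: Milne2020HodgeClassesAV, §2 2.2] -/
theorem exists_cmMember_hasWeilDiscriminantCM (hK : 2 < Module.finrank ℚ K)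
    {b₀ : 𝓞 K} (hb₀ : IsCMField.complexConj K (b₀ : K) = -(b₀ : K))
    (hsep : Function.Injective fun σ : K →+* ℂ => σ (b₀ : K))
    {R : Polynomial ℤ} {e₀ : ℕ} (he : Module.finrank ℚ K = 2 * e₀) (hRm : R.Monic) (hRdeg : R.natDegree = e₀)
    (hR : R.comp (X ^ 2) = minpoly ℤ b₀) (hirr : Irreducible (cmPolyQ R))
    (hroots : ∀ s : ℂ, Polynomial.eval₂ (Int.castRingHom ℂ) s R = 0 → s.im = 0 ∧ s.re < 0)
    (haev : Polynomial.aeval (b₀ : K) (cmPolyQ R) = 0) (hdegQ : (cmPolyQ R).natDegree = Module.finrank ℚ K)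
    [Fact (Irreducible (realPolyQ R))] {p : ℕ} (hp : 0 < p) (δ : cmNormResidueGroup R) :
    ∃ (A : AbelianVariety ℂ) (η : A ⟶ A) (h : complexBetti A.X 2),
      IsOfCMType A ∧ IsWeilTypeCM A η R e₀ p ∧ IsPolarizationClass A.dim A.X h ∧ RosatiCompatible A η h ∧
        HasWeilDiscriminantCM A η R e₀ p h δ := by
  -- a CM type `Ψ₀`, its complement `Ψ₁`, and realisations of both (Shimura §6.2 Thm. 3)
  obtain ⟨Ψ₀⟩ := nonempty_cmType_of_isCMField (K := K)
  let Ψ₁ : CMType K := ⟨(Ψ₀.1)ᶜ, fun φ => by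
    rw [Set.mem_compl_iff, Set.mem_compl_iff]
    exact not_congr (Ψ₀.2 φ)⟩
  obtain ⟨A₀, ι₀, θ₀, hA₀⟩ := exists_isCMTypeRealisation Ψ₀
  obtain ⟨A₁, ι₁, θ₁, hA₁⟩ := exists_isCMTypeRealisation Ψ₁
  -- the family: `p` slots `(A₀, Ψ₀)` followed by `p` slots `(A₁, Ψ₁)`
  let D := Σ' (A : AbelianVariety ℂ) (ι : 𝓞 K →+* End A) (θ : K →+* Module.End ℂ (complexBetti A.X 1))
    (Φ : CMType K), IsCMTypeRealisation Φ A ι θ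
  let d₀ : D := ⟨A₀, ι₀, θ₀, Ψ₀, hA₀⟩
  let d₁ : D := ⟨A₁, ι₁, θ₁, Ψ₁, hA₁⟩
  let fam : Fin (2 * p) → D := fun j => if (j : ℕ) < p then d₀ else d₁
  have hfam : ∀ j : Fin (2 * p), ((j : ℕ) < p → fam j = d₀) ∧ (¬ (j : ℕ) < p → fam j = d₁) := fun j =>
    ⟨fun hj => if_pos hj, fun hj => if_neg hj⟩
  have hmem : ∀ (s : K →+* ℂ) (j : Fin (2 * p)), s ∈ (fam j).2.2.2.1.1 ↔ ((j : ℕ) < p ↔ s ∈ Ψ₀.1) := by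
    intro s j
    by_cases hj : (j : ℕ) < p
    · rw [(hfam j).1 hj]
      exact ⟨fun h => ⟨fun _ => h, fun _ => hj⟩, fun h => h.1 hj⟩
    · rw [(hfam j).2 hj]
      change s ∈ (Ψ₀.1)ᶜ ↔ _
      rw [Set.mem_compl_iff]
      exact ⟨fun h => ⟨fun h' => absurd h' hj, fun h' => absurd h' h⟩, fun h h' => hj (h.2 h')⟩
  have hadm : ∀ s : K →+* ℂ,
      (Finset.univ.filter fun j : Fin (2 * p) => s ∈ (fam j).2.2.2.1.1).card = p := by
    intro s
    by_cases hs : s ∈ Ψ₀.1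
    · have hfilt : (Finset.univ.filter fun j : Fin (2 * p) => s ∈ (fam j).2.2.2.1.1) =
          Finset.univ.filter fun j : Fin (2 * p) => (j : ℕ) < p := by
        refine Finset.filter_congr fun j _ => ?_
        rw [hmem]
        exact ⟨fun h => h.2 hs, fun h => ⟨fun _ => hs, fun _ => h⟩⟩
      rw [hfilt, card_filter_val_lt]
    · have hfilt : (Finset.univ.filter fun j : Fin (2 * p) => s ∈ (fam j).2.2.2.1.1) =
          Finset.univ.filter fun j : Fin (2 * p) => ¬ (j : ℕ) < p := by
        refine Finset.filter_congr fun j _ => ?_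
        rw [hmem]
        exact ⟨fun h hj => hs (h.1 hj), fun h => ⟨fun hj => absurd hj h, fun h' => absurd h' hs⟩⟩
      rw [hfilt, card_filter_not_val_lt]
  obtain ⟨hW, h, hpol, hros, hdisc⟩ :=
    exists_polarizationClass_hasWeilDiscriminantCM_of_constantSum K hK rfl hp (fun j => (fam j).1)
      (fun j => (fam j).2.1) (fun j => (fam j).2.2.2.2) hadm hb₀ hsep he hRm hRdeg hR hirr hroots haev hdegQ δ
  refine ⟨⨁ fun j => (fam j).1, diagHom K (fun j => (fam j).1) (fun j => (fam j).2.1) b₀, h, ?_, hW, hpol, hros, hdisc⟩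
  exact CMCodimTwo.isOfCMType_biproduct_fin (fun j => (fam j).1) fun j => (fam j).2.2.2.2.isOfCMType

end Inhabited

end Summit.HodgeConjecture.HodgeConjecture.Ring2.WeilCoverageCM

end
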